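import Mathlib
import Literature.MathematicalPhysics.QuantumLattice.WilsonDiracAP
import Summits.QuantumFields.QCD.Theorems.QuarksAsStableActionCriticalLineDiamagnetismStubFreeBlochBlocks

/-!
# The free block propagator in the plane-wave basis: trace formulas
(helper for crux stmt-QuantumFields-9734, line `Sketch`, stub `stub_blockHessianFormula`; aux stub
`stub_blockHessianFormulaAux`)

What.  On the `2⁴` block `(ℤ/2)⁴` (colour `Fin 3`, spin `Fin 4`) with constant central link phases
`u_μ = e^{iθ_μ}·1`, the free `r = 1` Wilson–Dirac operator `B⁰ = wilsonDirac ρ₃ (fun e => u e.2) m 1` is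
diagonalised by the 16 REAL plane waves `χ_s(x) = (−1)^{s·x}`, `s ∈ (ℤ/2)⁴`:
`B⁰⁻¹ = P · blockdiag (1 ⊗ S(P_s)) · Pᴴ`, `P = F ⊗ 1`, `F(x,s) = χ_s(x)/4`, with the free propagator
`S(P) = (M_W(P)·1 − iΣ_κ sin P_κ γ_κ) / h(P)`, `M_W(P) = m + Σ_κ (1 − cos P_κ)`,
`h(P) = M_W(P)² + Σ_κ sin² P_κ`, at the block momenta `P_s = θ + π s` (when all `h(P_s) > 0`).
Consequently, for ALL matrices `A, B` on the block,
`tr (B⁰⁻¹ A) = (1/16) Σ_s tr ((1 ⊗ S(P_s)) Â(s,s))` and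
`tr (B⁰⁻¹ A B⁰⁻¹ B) = (1/256) Σ_{s,s'} tr ((1 ⊗ S(P_s)) Â(s,s') (1 ⊗ S(P_{s'})) B̂(s',s))`
with the momentum blocks `Â(s,s') = Σ_{y,z} χ_s(y) χ_{s'}(z) A[(y,·),(z,·)] ∈ M_{3×4}(ℂ)`
(`BlockHessianFormula.trace_formulas`, `stub_blockHessianFormulaAux`).

How.  `B⁰ P = P · blockdiag (1 ⊗ N(P_s))` is `FreeBlochBlocks.wilsonDirac_dirTwist_mul_planeP` at `L = 2`
(`N = M_W·1 + iΣ sin γ`); Clifford `Nᴴ N = h·1` gives `S N = 1`, so `B⁰ (P Sd Pᴴ) = P Pᴴ = 1`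
(`Matrix.inv_eq_right_inv`); then `tr (P Sd Pᴴ A P Sd Pᴴ B) = tr (Sd (PᴴAP) Sd (PᴴBP))` and the block
bookkeeping `trace_blockDiag_mul`, `trace_blockDiag_mul_mul`, `sandwich_apply`; `torusChar_two`:
on `(ℤ/2)⁴` the characters are the real signs `(−1)^{s·x}`.

References: Montvay–Münster, *Quantum Fields on a Lattice* §4.2 (free Wilson fermions in momentum
space); folklore linear algebra.  Pure theorem file (no `def`s).
-/

noncomputable section

open scoped BigOperators Classical Matrix ComplexConjugate
open Finset
open Literature.MathematicalPhysics.QuantumLattice Literature.MathematicalPhysics.QuantumFieldTheory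
  Literature.Probability.LatticeModels

namespace Summit.QuantumFields.QCD.Cruxes.CriticalLineDiamagnetism.ChessboardCellGain

open scoped Kronecker
open Complex (I)
open Summit.QuantumFields.QCD.Theorems.HeatSlicedQuarks.FreeKernel
open Summit.QuantumFields.QCD.Cruxes.TipNoBinding.PositivityNoLeakSpread

namespace BlockHessianFormula

/-! ### Characters of `(ℤ/2)⁴` are real signs -/

/-- On `(ℤ/2)⁴` the character `χ_k(x)` is the real sign `(−1)^{Σ_κ k_κ x_κ}`. -/
theorem torusChar_two (k x : TorusSite 4 2) :
    torusChar k x = (((-1 : ℝ) ^ (∑ κ, (k κ).val * (x κ).val) : ℝ) : ℂ) := by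
  rw [torusChar, Finset.prod_congr rfl fun i _ => stdAddChar_mul_eq_exp (k i) (x i)]
  push_cast
  rw [← Finset.prod_pow_eq_pow_sum]
  refine Finset.prod_congr rfl fun i _ => ?_
  rw [← Complex.exp_pi_mul_I, ← Complex.exp_nat_mul]
  congr 1
  push_cast
  ring

/-- In `(ℤ/2)⁴`: `k + (k + s) = s`. -/
theorem add_add_cancel_left (k s : Fin 4 → ZMod 2) : k + (k + s) = s := by
  have h2 : ∀ a b : ZMod 2, a + (a + b) = b := by decide
  funext i
  exact h2 _ _

/-- Representatives in `ZMod 2`: `val a + val b = val (a + b) + 2n`. -/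
theorem exists_val_add (a b : ZMod 2) : ∃ n : ℕ, a.val + b.val = (a + b).val + 2 * n :=
  ⟨(a.val + b.val) / 2, by rw [ZMod.val_add]; omega⟩

/-- The block momenta are defined through representatives; `cos`, `sin` and `e^{i·}` of
`θ + π val(a+b)` and of `θ + π val a + π val b` agree (`2π`-periodicity). -/
theorem trig_val_add (θ : ℝ) (a b : ZMod 2) :
    Real.cos (θ + Real.pi * ((a + b).val : ℝ)) = Real.cos (θ + Real.pi * (a.val : ℝ) + Real.pi * (b.val : ℝ)) ∧
    Real.sin (θ + Real.pi * ((a + b).val : ℝ)) = Real.sin (θ + Real.pi * (a.val : ℝ) + Real.pi * (b.val : ℝ)) ∧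
    Complex.exp (↑(θ + Real.pi * ((a + b).val : ℝ)) * I) =
      Complex.exp (↑(θ + Real.pi * (a.val : ℝ) + Real.pi * (b.val : ℝ)) * I) := by
  obtain ⟨n, hn⟩ := exists_val_add a b
  have h : θ + Real.pi * (a.val : ℝ) + Real.pi * (b.val : ℝ) =
      θ + Real.pi * ((a + b).val : ℝ) + n * (2 * Real.pi) := by
    have : (a.val : ℝ) + b.val = (a + b).val + 2 * n := by exact_mod_cast hn
    linear_combination Real.pi * this
  rw [h, Real.cos_add_nat_mul_two_pi, Real.sin_add_nat_mul_two_pi]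
  refine ⟨rfl, rfl, ?_⟩
  rw [Complex.ofReal_add (θ + _), add_mul, Complex.exp_add]
  push_cast
  rw [show (n : ℂ) * (2 * Real.pi) * I = n * (2 * Real.pi * I) by ring,
    Complex.exp_nat_mul_two_pi_mul_I, mul_one]

/-- For anti-Hermitian `A, B`: `tr (Aᴴ B) = −tr (A B)`, and `tr (A B)` is real. -/
theorem trace_mul_of_antiHerm {n : Type*} [Fintype n] (A B : Matrix n n ℂ) (hA : Aᴴ = -A)
    (hB : Bᴴ = -B) : (Aᴴ * B).trace = -(A * B).trace ∧ ((A * B).trace).im = 0 := by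
  refine ⟨by rw [hA, neg_mul, Matrix.trace_neg], ?_⟩
  have h : star ((A * B).trace) = (A * B).trace := by
    rw [← Matrix.trace_conjTranspose, Matrix.conjTranspose_mul, hA, hB, neg_mul_neg,
      Matrix.trace_mul_comm]
  exact Complex.conj_eq_iff_im.mp h

/-! ### Block bookkeeping on `K × C` -/

section Blocks

variable {K C : Type*} [Fintype K] [DecidableEq K] [Fintype C]

/-- `tr (M₁ M₂) = Σ_i Σ_j (M₁)ᵢⱼ (M₂)ⱼᵢ`. -/
theorem trace_mul_eq_sum {ι : Type*} [Fintype ι] (M₁ M₂ : Matrix ι ι ℂ) :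
    (M₁ * M₂).trace = ∑ i, ∑ j, M₁ i j * M₂ j i := by
  simp only [Matrix.trace, Matrix.diag, Matrix.mul_apply]

/-- Product of two block-diagonal matrices. -/
theorem blockDiag_mul_blockDiag (T T' : K → Matrix C C ℂ) :
    (Matrix.of fun q q' : K × C => if q.1 = q'.1 then T q.1 q.2 q'.2 else 0) *
        (Matrix.of fun q q' : K × C => if q.1 = q'.1 then T' q.1 q.2 q'.2 else 0) =
      Matrix.of fun q q' : K × C => if q.1 = q'.1 then (T q.1 * T' q.1) q.2 q'.2 else 0 := by
  ext ⟨k, c⟩ ⟨k', c'⟩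
  simp only [Matrix.mul_apply, Matrix.of_apply, Fintype.sum_prod_type]
  rw [Finset.sum_eq_single k]
  · by_cases h : k = k'
    · subst h
      simp
    · simp [h]
  · intro k₁ _ hk
    simp [Ne.symm hk]
  · simp

/-- The `(q, p)` entry of a block-diagonal matrix times a matrix. -/
theorem blockDiag_mul_apply (T : K → Matrix C C ℂ) (X₁ : Matrix (K × C) (K × C) ℂ) (q p : K × C) :
    ((Matrix.of fun q q' : K × C => if q.1 = q'.1 then T q.1 q.2 q'.2 else 0) * X₁) q p =
      (T q.1 * Matrix.of fun c c' => X₁ (q.1, c) (p.1, c')) q.2 p.2 := by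
  rw [Matrix.mul_apply, Fintype.sum_prod_type, Finset.sum_eq_single q.1]
  · simp [Matrix.mul_apply]
  · intro k₁ _ hk
    simp [Ne.symm hk]
  · simp

/-- Trace of a block-diagonal matrix times a matrix, blockwise. -/
theorem trace_blockDiag_mul (T : K → Matrix C C ℂ) (X₁ : Matrix (K × C) (K × C) ℂ) :
    ((Matrix.of fun q q' : K × C => if q.1 = q'.1 then T q.1 q.2 q'.2 else 0) * X₁).trace =
      ∑ k, (T k * Matrix.of fun c c' => X₁ (k, c) (k, c')).trace := by
  simp only [Matrix.trace, Matrix.diag]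
  simp_rw [blockDiag_mul_apply, Fintype.sum_prod_type]

/-- Trace of a product of two (block-diagonal × matrix) factors, blockwise. -/
theorem trace_blockDiag_mul_mul (T T' : K → Matrix C C ℂ) (X₁ X₂ : Matrix (K × C) (K × C) ℂ) :
    ((Matrix.of fun q q' : K × C => if q.1 = q'.1 then T q.1 q.2 q'.2 else 0) * X₁ *
        ((Matrix.of fun q q' : K × C => if q.1 = q'.1 then T' q.1 q.2 q'.2 else 0) * X₂)).trace =
      ∑ k, ∑ k', (T k * (Matrix.of fun c c' => X₁ (k, c) (k', c')) *
        (T' k' * Matrix.of fun c c' => X₂ (k', c) (k, c'))).trace := by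
  rw [trace_mul_eq_sum]
  simp_rw [blockDiag_mul_apply, trace_mul_eq_sum, Fintype.sum_prod_type]
  exact Finset.sum_congr rfl fun k _ => Finset.sum_comm

/-- The plane-wave matrix `F ⊗ 1` times a block-diagonal matrix. -/
theorem kron_one_mul_blockDiag [DecidableEq C] {X : Type*} (F : Matrix X K ℂ)
    (T : K → Matrix C C ℂ) :
    F ⊗ₖ (1 : Matrix C C ℂ) *
        (Matrix.of fun q q' : K × C => if q.1 = q'.1 then T q.1 q.2 q'.2 else 0) =
      Matrix.of fun (p : X × C) (q : K × C) => F p.1 q.1 * T q.1 p.2 q.2 := by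
  ext ⟨x, c⟩ ⟨k, c'⟩
  simp only [Matrix.mul_apply, Matrix.of_apply, Fintype.sum_prod_type, Matrix.kronecker_apply]
  rw [Finset.sum_eq_single k]
  · rw [Finset.sum_eq_single c]
    · simp
    · intro c₁ _ hc
      simp [Matrix.one_apply_ne (Ne.symm hc)]
    · simp
  · intro k₁ _ hk
    simp [hk]
  · simp

omit [Fintype K] [DecidableEq K] in
/-- The momentum blocks of `Pᴴ A P` for `P = F ⊗ 1`. -/
theorem sandwich_apply [DecidableEq C] {X : Type*} [Fintype X] (F : Matrix X K ℂ)
    (A : Matrix (X × C) (X × C) ℂ) (q q' : K × C) :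
    ((F ⊗ₖ (1 : Matrix C C ℂ))ᴴ * A * F ⊗ₖ (1 : Matrix C C ℂ)) q q' =
      ∑ y : X, ∑ z : X, star (F y q.1) * F z q'.1 * A (y, q.2) (z, q'.2) := by
  have h1 : ∀ p : X × C, ((F ⊗ₖ (1 : Matrix C C ℂ))ᴴ * A) q p =
      ∑ y : X, star (F y q.1) * A (y, q.2) p := by
    intro p
    rw [Matrix.mul_apply, Fintype.sum_prod_type]
    refine Finset.sum_congr rfl fun y _ => ?_
    rw [Finset.sum_eq_single q.2]
    · simp [Matrix.conjTranspose_apply]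
    · intro c _ hc
      simp [Matrix.conjTranspose_apply, Matrix.one_apply_ne hc]
    · simp
  have h2 : ∀ z : X, ∑ c : C, (∑ y : X, star (F y q.1) * A (y, q.2) (z, c)) *
      (F ⊗ₖ (1 : Matrix C C ℂ)) (z, c) q' =
        ∑ y : X, star (F y q.1) * F z q'.1 * A (y, q.2) (z, q'.2) := by
    intro z
    rw [Finset.sum_eq_single q'.2]
    · rw [Matrix.kronecker_apply, Matrix.one_apply_eq, mul_one, Finset.sum_mul]
      refine Finset.sum_congr rfl fun y _ => ?_
      ring
    · intro c _ hc
      rw [Matrix.kronecker_apply, Matrix.one_apply_ne hc, mul_zero, mul_zero]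
    · intro h; exact absurd (Finset.mem_univ _) h
  rw [Matrix.mul_apply]
  simp_rw [h1]
  rw [Fintype.sum_prod_type]
  simp_rw [h2]
  exact Finset.sum_comm

end Blocks

/-! ### The free block operator in the plane-wave basis -/

/-- The adjoint of the colour–spin symbol `w·1 + iΣ s_κ γ_κ` (`w`, `s` real) is `w·1 − iΣ s_κ γ_κ`. -/
theorem symbol_conjTranspose (w : ℝ) (s : Fin 4 → ℝ) :
    ((w : ℂ) • (1 : Matrix (Fin 4) (Fin 4) ℂ) + I • ∑ κ, ((s κ : ℝ) : ℂ) • euclideanGamma κ)ᴴ =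
      (w : ℂ) • (1 : Matrix (Fin 4) (Fin 4) ℂ) - I • ∑ κ, ((s κ : ℝ) : ℂ) • euclideanGamma κ := by
  rw [Matrix.conjTranspose_add, Matrix.conjTranspose_smul, Matrix.conjTranspose_smul,
    Matrix.conjTranspose_one, Matrix.conjTranspose_sum]
  simp only [Matrix.conjTranspose_smul, (euclideanGamma_isHermitian _).eq, Complex.star_def,
    Complex.conj_ofReal, Complex.conj_I, neg_smul, sub_eq_add_neg]

/-- **Clifford inverse of the symbol**: `S := (w·1 − iΣ s γ)/h` with `h = w² + Σ s² ≠ 0` is a left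
inverse of `N = w·1 + iΣ s γ`. -/
theorem symbolInv_mul_symbol (w : ℝ) (s : Fin 4 → ℝ) (hne : w ^ 2 + ∑ κ, s κ ^ 2 ≠ 0) :
    (((w ^ 2 + ∑ κ, s κ ^ 2 : ℝ) : ℂ)⁻¹ •
        ((w : ℂ) • (1 : Matrix (Fin 4) (Fin 4) ℂ) - I • ∑ κ, ((s κ : ℝ) : ℂ) • euclideanGamma κ)) *
      ((w : ℂ) • (1 : Matrix (Fin 4) (Fin 4) ℂ) + I • ∑ κ, ((s κ : ℝ) : ℂ) • euclideanGamma κ) = 1 := by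
  rw [← symbol_conjTranspose, Matrix.smul_mul, clifford_conjTranspose_mul_self, smul_smul,
    inv_mul_cancel₀ (Complex.ofReal_ne_zero.mpr hne), one_smul]

section FreeBlock

variable (m : ℝ) (θ : Fin 4 → ℝ) (u : Fin 4 → Matrix.unitaryGroup (Fin 3) ℂ)
  (B0 : Matrix (TorusSite 4 2 × Fin 3 × Fin 4) (TorusSite 4 2 × Fin 3 × Fin 4) ℂ)
  (Mw h : (Fin 4 → ℝ) → ℝ) (S : (Fin 4 → ℝ) → Matrix (Fin 4) (Fin 4) ℂ)
  (mom : (Fin 4 → ZMod 2) → Fin 4 → ℝ) (chi : (Fin 4 → ZMod 2) → TorusSite 4 2 → ℝ)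
  (hat : Matrix (TorusSite 4 2 × Fin 3 × Fin 4) (TorusSite 4 2 × Fin 3 × Fin 4) ℂ →
    (Fin 4 → ZMod 2) → (Fin 4 → ZMod 2) → Matrix (Fin 3 × Fin 4) (Fin 3 × Fin 4) ℂ)

/-- **`B⁰⁻¹ = P · blockdiag (1 ⊗ S(P_s)) · Pᴴ`** for the free block operator with constant central
direction phases, `P = F ⊗ 1` the unitary plane-wave matrix (all `h(P_s) > 0`). -/
theorem inv_eq
    (hu : ∀ μ, (u μ : Matrix (Fin 3) (Fin 3) ℂ) = Complex.exp (↑(θ μ) * I) • (1 : Matrix (Fin 3) (Fin 3) ℂ))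
    (hB0 : B0 = wilsonDirac (unitaryFundamentalRep (Fin 3) ℂ) (fun e : Edge 4 2 => u e.2) m 1)
    (hMw : ∀ P, Mw P = m + ∑ κ, (1 - Real.cos (P κ)))
    (hh : ∀ P, h P = Mw P ^ 2 + ∑ κ, Real.sin (P κ) ^ 2)
    (hS : ∀ P, S P = ((h P)⁻¹ : ℂ) • (((Mw P : ℝ) : ℂ) • (1 : Matrix (Fin 4) (Fin 4) ℂ) -
      I • ∑ κ, ((Real.sin (P κ) : ℝ) : ℂ) • euclideanGamma κ))
    (hmom : ∀ s κ, mom s κ = θ κ + Real.pi * ((s κ).val : ℝ)) (hpos : ∀ s, 0 < h (mom s)) :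
    B0⁻¹ = (Matrix.of fun x k : TorusSite 4 2 => (((2 : ℕ) : ℂ) ^ 2)⁻¹ * torusChar k x) ⊗ₖ
        (1 : Matrix (Fin 3 × Fin 4) (Fin 3 × Fin 4) ℂ) *
      (Matrix.of fun q q' : TorusSite 4 2 × Fin 3 × Fin 4 =>
        if q.1 = q'.1 then ((1 : Matrix (Fin 3) (Fin 3) ℂ) ⊗ₖ S (mom q.1)) q.2 q'.2 else 0) *
      ((Matrix.of fun x k : TorusSite 4 2 => (((2 : ℕ) : ℂ) ^ 2)⁻¹ * torusChar k x) ⊗ₖ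
        (1 : Matrix (Fin 3 × Fin 4) (Fin 3 × Fin 4) ℂ))ᴴ := by
  -- the plane-wave diagonalisation `B⁰ P = P · blockdiag (1 ⊗ N)` at `L = 2`
  have hθ' : ∀ v t : ℝ, 2 * Real.pi * v / ((2 : ℕ) : ℝ) + t = t + Real.pi * v := fun v t => by
    push_cast; ring
  have hA := FreeBlochBlocks.wilsonDirac_dirTwist_mul_planeP (L := 2) θ m u hu
  simp only [hθ'] at hA
  set P : Matrix (TorusSite 4 2 × Fin 3 × Fin 4) (TorusSite 4 2 × Fin 3 × Fin 4) ℂ :=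
    (Matrix.of fun x k : TorusSite 4 2 => (((2 : ℕ) : ℂ) ^ 2)⁻¹ * torusChar k x) ⊗ₖ
      (1 : Matrix (Fin 3 × Fin 4) (Fin 3 × Fin 4) ℂ) with hP
  set N : TorusSite 4 2 → Matrix (Fin 4) (Fin 4) ℂ := fun k =>
    (((m + ∑ μ, (1 - Real.cos (θ μ + Real.pi * ((k μ).val : ℝ)))) : ℝ) : ℂ) •
        (1 : Matrix (Fin 4) (Fin 4) ℂ) +
      I • ∑ μ, ((Real.sin (θ μ + Real.pi * ((k μ).val : ℝ)) : ℝ) : ℂ) • euclideanGamma μ with hN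
  have hBP : B0 * P = P * Matrix.of fun q q' : TorusSite 4 2 × Fin 3 × Fin 4 =>
      if q.1 = q'.1 then ((1 : Matrix (Fin 3) (Fin 3) ℂ) ⊗ₖ N q.1) q.2 q'.2 else 0 := by
    rw [hP, kron_one_mul_blockDiag _ (fun k => (1 : Matrix (Fin 3) (Fin 3) ℂ) ⊗ₖ N k), hB0]
    exact hA
  -- the Clifford inverse blockwise: `S(P_k) N(k) = 1`
  have hSN : ∀ k : TorusSite 4 2, S (mom k) * N k = 1 := by
    intro k
    have hk := hpos k
    rw [hh, hMw] at hk
    rw [hS, hh, hMw, hN]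
    simp only [hmom] at hk ⊢
    exact symbolInv_mul_symbol _ (fun μ => Real.sin (θ μ + Real.pi * ((k μ).val : ℝ))) hk.ne'
  have hNS : (Matrix.of fun q q' : TorusSite 4 2 × Fin 3 × Fin 4 =>
      if q.1 = q'.1 then ((1 : Matrix (Fin 3) (Fin 3) ℂ) ⊗ₖ N q.1) q.2 q'.2 else 0) *
      (Matrix.of fun q q' : TorusSite 4 2 × Fin 3 × Fin 4 =>
        if q.1 = q'.1 then ((1 : Matrix (Fin 3) (Fin 3) ℂ) ⊗ₖ S (mom q.1)) q.2 q'.2 else 0) = 1 := by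
    rw [blockDiag_mul_blockDiag (fun k => (1 : Matrix (Fin 3) (Fin 3) ℂ) ⊗ₖ N k)
      (fun k => (1 : Matrix (Fin 3) (Fin 3) ℂ) ⊗ₖ S (mom k))]
    ext ⟨k, c⟩ ⟨k', c'⟩
    have h1 : (1 : Matrix (Fin 3) (Fin 3) ℂ) ⊗ₖ N k * (1 : Matrix (Fin 3) (Fin 3) ℂ) ⊗ₖ S (mom k) = 1 := by
      rw [← Matrix.mul_kronecker_mul, Matrix.one_mul, mul_eq_one_comm.1 (hSN k),
        Matrix.one_kronecker_one]
    simp only [Matrix.of_apply, h1, Matrix.one_apply, Prod.mk.injEq]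
    by_cases hk : k = k' <;> simp [hk]
  have hPu : Pᴴ * P = 1 := by rw [hP]; exact planeP_conjTranspose_mul_self
  have hPP : P * Pᴴ = 1 := mul_eq_one_comm.1 hPu
  refine Matrix.inv_eq_right_inv ?_
  rw [← Matrix.mul_assoc, ← Matrix.mul_assoc, hBP, Matrix.mul_assoc P, hNS, Matrix.mul_one, hPP]

/-- **Trace formulas in the plane-wave basis** (abstract form of `stub_blockHessianFormulaAux`): with the
momentum blocks `Â(k,k') = Σ_{y,z} χ_k(y) χ_{k'}(z) A[(y,·),(z,·)]`,
`tr (B⁰⁻¹ A) = (1/16) Σ_k tr ((1 ⊗ S(P_k)) Â(k,k))` and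
`tr (B⁰⁻¹ A B⁰⁻¹ B) = (1/256) Σ_{k,k'} tr ((1 ⊗ S(P_k)) Â(k,k') (1 ⊗ S(P_{k'})) B̂(k',k))`. -/
theorem trace_formulas
    (hu : ∀ μ, (u μ : Matrix (Fin 3) (Fin 3) ℂ) = Complex.exp (↑(θ μ) * I) • (1 : Matrix (Fin 3) (Fin 3) ℂ))
    (hB0 : B0 = wilsonDirac (unitaryFundamentalRep (Fin 3) ℂ) (fun e : Edge 4 2 => u e.2) m 1)
    (hMw : ∀ P, Mw P = m + ∑ κ, (1 - Real.cos (P κ)))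
    (hh : ∀ P, h P = Mw P ^ 2 + ∑ κ, Real.sin (P κ) ^ 2)
    (hS : ∀ P, S P = ((h P)⁻¹ : ℂ) • (((Mw P : ℝ) : ℂ) • (1 : Matrix (Fin 4) (Fin 4) ℂ) -
      I • ∑ κ, ((Real.sin (P κ) : ℝ) : ℂ) • euclideanGamma κ))
    (hmom : ∀ s κ, mom s κ = θ κ + Real.pi * ((s κ).val : ℝ))
    (hchi : ∀ s x, chi s x = (-1 : ℝ) ^ (∑ κ, (s κ).val * (x κ).val))
    (hhat : ∀ A k k', hat A k k' =
      ∑ y, ∑ z, ((chi k y * chi k' z : ℝ) : ℂ) • Matrix.of fun c c' : Fin 3 × Fin 4 => A (y, c) (z, c'))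
    (hpos : ∀ s, 0 < h (mom s)) :
    (∀ A, (B0⁻¹ * A).trace =
      (1 / 16 : ℂ) * ∑ k, ((1 : Matrix (Fin 3) (Fin 3) ℂ) ⊗ₖ S (mom k) * hat A k k).trace) ∧
    (∀ A B, (B0⁻¹ * A * (B0⁻¹ * B)).trace = (1 / 256 : ℂ) * ∑ k, ∑ k',
      ((1 : Matrix (Fin 3) (Fin 3) ℂ) ⊗ₖ S (mom k) * hat A k k' *
        ((1 : Matrix (Fin 3) (Fin 3) ℂ) ⊗ₖ S (mom k') * hat B k' k)).trace) := by
  have hinv := inv_eq m θ u B0 Mw h S mom hu hB0 hMw hh hS hmom hpos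
  set P : Matrix (TorusSite 4 2 × Fin 3 × Fin 4) (TorusSite 4 2 × Fin 3 × Fin 4) ℂ :=
    (Matrix.of fun x k : TorusSite 4 2 => (((2 : ℕ) : ℂ) ^ 2)⁻¹ * torusChar k x) ⊗ₖ
      (1 : Matrix (Fin 3 × Fin 4) (Fin 3 × Fin 4) ℂ) with hP
  set Sd : Matrix (TorusSite 4 2 × Fin 3 × Fin 4) (TorusSite 4 2 × Fin 3 × Fin 4) ℂ :=
    Matrix.of fun q q' : TorusSite 4 2 × Fin 3 × Fin 4 =>
      if q.1 = q'.1 then ((1 : Matrix (Fin 3) (Fin 3) ℂ) ⊗ₖ S (mom q.1)) q.2 q'.2 else 0 with hSd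
  have hct : ∀ k y : TorusSite 4 2, torusChar k y = ((chi k y : ℝ) : ℂ) := fun k y => by
    rw [torusChar_two, hchi]
  -- the momentum blocks of `Pᴴ A P`
  have hblock : ∀ (A : Matrix (TorusSite 4 2 × Fin 3 × Fin 4) (TorusSite 4 2 × Fin 3 × Fin 4) ℂ)
      (k k' : TorusSite 4 2),
      (Matrix.of fun c c' : Fin 3 × Fin 4 => (Pᴴ * A * P) (k, c) (k', c')) = (1 / 16 : ℂ) • hat A k k' := by
    intro A k k'
    ext c c'
    rw [Matrix.of_apply, hP, sandwich_apply, hhat]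
    simp only [Matrix.smul_apply, Matrix.sum_apply, Matrix.of_apply, smul_eq_mul, Finset.mul_sum, hct,
      star_mul', Complex.star_def, Complex.conj_ofReal, map_inv₀, map_pow, map_natCast,
      Complex.ofReal_mul]
    refine Finset.sum_congr rfl fun y _ => Finset.sum_congr rfl fun z _ => ?_
    push_cast
    ring
  refine ⟨fun A => ?_, fun A B => ?_⟩
  · rw [hinv, show P * Sd * Pᴴ * A = P * (Sd * (Pᴴ * A)) by simp only [Matrix.mul_assoc],
      Matrix.trace_mul_comm, show Sd * (Pᴴ * A) * P = Sd * (Pᴴ * A * P) by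
        simp only [Matrix.mul_assoc], hSd,
      trace_blockDiag_mul (fun k => (1 : Matrix (Fin 3) (Fin 3) ℂ) ⊗ₖ S (mom k)) (Pᴴ * A * P),
      Finset.mul_sum]
    refine Finset.sum_congr rfl fun k _ => ?_
    rw [hblock]
    simp only [Matrix.mul_smul, Matrix.trace_smul, smul_eq_mul]
  · rw [hinv, show P * Sd * Pᴴ * A * (P * Sd * Pᴴ * B) = P * (Sd * (Pᴴ * A * P) * (Sd * (Pᴴ * B))) by
        simp only [Matrix.mul_assoc], Matrix.trace_mul_comm,
      show Sd * (Pᴴ * A * P) * (Sd * (Pᴴ * B)) * P = Sd * (Pᴴ * A * P) * (Sd * (Pᴴ * B * P)) by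
        simp only [Matrix.mul_assoc], hSd,
      trace_blockDiag_mul_mul (fun k => (1 : Matrix (Fin 3) (Fin 3) ℂ) ⊗ₖ S (mom k))
        (fun k => (1 : Matrix (Fin 3) (Fin 3) ℂ) ⊗ₖ S (mom k)) (Pᴴ * A * P) (Pᴴ * B * P), Finset.mul_sum]
    refine Finset.sum_congr rfl fun k _ => ?_
    rw [Finset.mul_sum]
    refine Finset.sum_congr rfl fun k' _ => ?_
    rw [hblock, hblock]
    simp only [Matrix.mul_smul, Matrix.smul_mul, Matrix.trace_smul, smul_eq_mul]
    ring

end FreeBlock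

end BlockHessianFormula

open BlockHessianFormula in
/-- **Aux stub `stub_blockHessianFormulaAux`** (plane-wave trace formulas for the free block propagator):
on the `2⁴` block with constant central phases `u_μ = e^{iθ_μ}·1` and all `h(θ + πs) > 0`, for ALL
matrices `A, B`: `tr (B⁰⁻¹ A) = (1/16) Σ_k tr ((1 ⊗ S(P_k)) Â(k,k))` and
`tr (B⁰⁻¹ A B⁰⁻¹ B) = (1/256) Σ_{k,k'} tr ((1 ⊗ S(P_k)) Â(k,k') (1 ⊗ S(P_{k'})) B̂(k',k))`,
`Â(k,k') = Σ_{y,z} χ_k(y) χ_{k'}(z) A[(y,·),(z,·)]`, `χ_s(x) = (−1)^{s·x}`, `P_k = θ + πk`,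
`S(P) = (M_W(P) − iΣ sin P_κ γ_κ)/h(P)`. -/
theorem stub_blockHessianFormulaAux : ∀ (m : ℝ) (θ : Fin 4 → ℝ) (u : Fin 4 → Matrix.unitaryGroup (Fin 3) ℂ), (∀ μ, ((u μ : Matrix.unitaryGroup (Fin 3) ℂ) : Matrix (Fin 3) (Fin 3) ℂ) = Complex.exp (↑(θ μ) * Complex.I) • (1 : Matrix (Fin 3) (Fin 3) ℂ)) → let B0 : Matrix (TorusSite 4 2 × Fin 3 × Fin 4) (TorusSite 4 2 × Fin 3 × Fin 4) ℂ := wilsonDirac (unitaryFundamentalRep (Fin 3) ℂ) (fun e : Edge 4 2 => u e.2) m 1; let Mw : (Fin 4 → ℝ) → ℝ := fun P => m + ∑ κ : Fin 4, (1 - Real.cos (P κ)); let h : (Fin 4 → ℝ) → ℝ := fun P => Mw P ^ 2 + ∑ κ : Fin 4, Real.sin (P κ) ^ 2; let S : (Fin 4 → ℝ) → Matrix (Fin 4) (Fin 4) ℂ := fun P => ((h P)⁻¹ : ℂ) • (((Mw P : ℝ) : ℂ) • (1 : Matrix (Fin 4) (Fin 4) ℂ) - Complex.I • ∑ κ : Fin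 4, ((Real.sin (P κ) : ℝ) : ℂ) • euclideanGamma κ); let mom : (Fin 4 → ZMod 2) → (Fin 4 → ℝ) := fun s κ => θ κ + Real.pi * ((s κ).val : ℝ); let chi : (Fin 4 → ZMod 2) → TorusSite 4 2 → ℝ := fun s x => (-1 : ℝ) ^ (∑ κ : Fin 4, (s κ).val * (x κ).val); let hat : Matrix (TorusSite 4 2 × Fin 3 × Fin 4) (TorusSite 4 2 × Fin 3 × Fin 4) ℂ → (Fin 4 → ZMod 2) → (Fin 4 → ZMod 2) → Matrix (Fin 3 × Fin 4) (Fin 3 × Fin 4) ℂ := fun A k k' => ∑ y : TorusSite 4 2, ∑ z : TorusSite 4 2, ((chi k y * chi k' z : ℝ) : ℂ) • Matrix.of (fun c c' : Fin 3 × Fin 4 => A (y, c) (z, c')); (∀ s : Fin 4 → ZMod 2, 0 < h (mom s)) → (∀ A : Matrix (TorusSite 4 2 × Fin 3 × Fin 4) (TorusSite 4 2 × Fin 3 × Fin 4) ℂ, (B0⁻¹ * A).trace = (1 / 16 : ℂ) * ∑ k : Fin 4 → ZMod 2, (Matrix.kroneckerMap (fun a b => a * b) (1 : Matrix (Fin 3)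 (Fin 3) ℂ) (S (mom k)) * hat A k k).trace) ∧ (∀ A B : Matrix (TorusSite 4 2 × Fin 3 × Fin 4) (TorusSite 4 2 × Fin 3 × Fin 4) ℂ, (B0⁻¹ * A * (B0⁻¹ * B)).trace = (1 / 256 : ℂ) * ∑ k : Fin 4 → ZMod 2, ∑ k' : Fin 4 → ZMod 2, (Matrix.kroneckerMap (fun a b => a * b) (1 : Matrix (Fin 3) (Fin 3) ℂ) (S (mom k)) * hat A k k' * (Matrix.kroneckerMap (fun a b => a * b) (1 : Matrix (Fin 3) (Fin 3) ℂ) (S (mom k')) * hat B k' k)).trace) := by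
  intro m θ u hu B0 Mw h S mom chi hat hpos
  exact trace_formulas m θ u B0 Mw h S mom chi hat hu rfl (fun _ => rfl) (fun _ => rfl) (fun _ => rfl)
    (fun _ _ => rfl) (fun _ _ => rfl) (fun _ _ _ => rfl) hpos

end Summit.QuantumFields.QCD.Cruxes.CriticalLineDiamagnetism.ChessboardCellGain

end
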